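import Mathlib.Analysis.InnerProductSpace.Positive
import Mathlib.Data.ZMod.ValMinAbs
import HarnessLib

/-!
# Knabe's local-gap amplification on the index torus `(ℤ/M)⁴` — vocabulary

Knabe's combinatorial device (Knabe 1988; Gosset–Mozgunov 2016; Lemm–Mozgunov 2019) turns a LOCAL spectral-gap
inequality for a frustration-free sum of orthogonal projections into a GLOBAL one: if `H = ∑ₓ Qₓ` with `Qₓ² = Qₓ = Qₓ*`,
projections commuting unless their indices are close, and every patch operator `A_x = ∑_{y ∈ patch(x)} Q_y` satisfies
`γ A_x ≤ A_x²` ("gap `≥ γ` above its kernel"), then `c (γ − t(n)) H ≤ H²` with an explicit threshold `t(n) → 0`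
(`n` the patch radius) — Knabe's squaring argument: `∑ₓ A_x² = ∑_{y,z} N(y,z) Q_y Q_z`, far pairs are products of
commuting projections hence `≥ 0`, near pairs are controlled by `−(PQ + QP) ≤ P + Q` and pair counting.

This file fixes the VOCABULARY only (definitions; the theorem `∃ t → 0, c > 0, KnabeWith 2 t c` is proved in
`KnabeGapAmplificationProofs.lean`): the cyclic index distance `cdist` on `Fin M` read in `ℤ/M`, the patch and total
operators `patchOp`, `totalOp` for a family of bounded operators on a real Hilbert space indexed by the 4-torus
`Fin 4 → Fin M`, and the predicate `KnabeWith R t c` — "the device holds with non-commuting radius `R`, threshold `t`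
and constant `c`", stated in Mathlib's Loewner order on `E →L[ℝ] E`.  The special case recorded is the one consumed by
block-dynamics arguments on four-dimensional tori (index set `(ℤ/M)⁴`, sup-metric patches).
-- TODO(general form): Knabe 1988 / Gosset–Mozgunov 2016 state the device for general translation-invariant
-- finite-range projector families on `ℤᵈ` (open and periodic chains, `d = 1, 2`), with sharper thresholds.
-- DONE for periodic chains (`d = 1`, nearest-neighbour bond projections `P : ℤ/N → M_n(ℂ)`):
-- `Literature/MathematicalPhysics/QuantumLattice/SpinChainsKnabeBlockProofs.lean` (Knabe's threshold `1/(n-1)`,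
-- every block length, `knabe_ring_block_sq_sub_smul_posSemidef`) and `…/SpinChainsGossetMozgunovProofs.lean`
-- (Gosset–Mozgunov Thm. 3, threshold `6/(n(n+1))`, `gossetMozgunov_ring_sq_sub_smul_posSemidef`; proved without
-- translation invariance).  DONE for open chains (`…/SpinChainsLemmMozgunovProofs.lean`: Lemm–Mozgunov 2019 Thm. 2.2
-- with boundary projectors, `lemmMozgunov_ring_sq_sub_smul_posSemidef`, `lemmMozgunov_thm22_sq_sub_smul_posSemidef`)
-- and for `d = 2` (`…/SquareLatticeFiniteSizeCriterion.lean`: Lemm–Xiang 2022 Prop. 3.1 on the torus `(ℤ/L)²`,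
-- `squareLattice_sq_sub_smul_posSemidef`, and the `ℓ⁻²` criterion `H² ≥ (25/36)(ε − 9/ℓ²)H`,
-- `squareLattice_sq_sub_smul_posSemidef_gmWeights`; Gosset–Mozgunov's own `n × (n+2)` patch version, Thm. 5 with
-- `8/n²`, is not restated).  Remaining (not needed by any route so far): `d ≥ 3` (Lemm–Xiang Prop. 3.1 general `D`),
-- honeycomb / triangular lattices (Lemm–Xiang Thms. 1–2).

References: S. Knabe, J. Stat. Phys. 52 (1988) 627–638, §2; D. Gosset, E. Mozgunov, J. Math. Phys. 57 (2016)
091901, Thm. 1; M. Lemm, E. Mozgunov, J. Math. Phys. 60 (2019) 051901; M. Lemm, D. Xiang, J. Phys. A 55 (2022)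
295203, Prop. 3.1.
-/

open scoped BigOperators

noncomputable section

namespace Literature.Analysis.OperatorTheory.KnabeDevice

/-- Cyclic distance of two indices of `Fin M`, read in `ℤ/M`: `|i − j|` around the circle
(`ZMod.valMinAbs` of the difference). [folklore] -/
def cdist {M : ℕ} (i j : Fin M) : ℕ :=
  ((((i : ℕ) : ZMod M) - ((j : ℕ) : ZMod M)).valMinAbs).natAbs

section Device

variable {E : Type} [NormedAddCommGroup E] [InnerProductSpace ℝ E] [CompleteSpace E] {M : ℕ}

/-- The `n`-patch operator at `x`: `A_x = ∑_{y : sup-cdist(y, x) < n} Q y` (a cube of side `2n − 1` indices around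
`x` on the index torus `(ℤ/M)⁴`) (Knabe 1988 §2, the operators `h_{n,i}`). [cite: Knabe1988, §2] -/
def patchOp (Q : (Fin 4 → Fin M) → (E →L[ℝ] E)) (n : ℕ) (x : Fin 4 → Fin M) : E →L[ℝ] E :=
  ∑ y : Fin 4 → Fin M, if (∀ k, cdist (y k) (x k) < n) then Q y else 0

/-- The total operator `H = ∑ₓ Q x` (Knabe 1988 §2, the Hamiltonian `H_N`). [cite: Knabe1988, §2] -/
def totalOp (Q : (Fin 4 → Fin M) → (E →L[ℝ] E)) : E →L[ℝ] E :=
  ∑ x : Fin 4 → Fin M, Q x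

end Device

/-- **Knabe-type amplification with non-commuting radius `R`, threshold `t` and constant `c`** (Knabe 1988 Thm./§2;
Gosset–Mozgunov 2016 Thm. 1; stated for orthogonal projections on a REAL Hilbert space indexed by the 4-torus
`(ℤ/M)⁴`, commuting as soon as the indices differ by more than `R` in some axis, in the Loewner order): if every
`n`-patch operator satisfies `γ A_x ≤ A_x²` then `c (γ − t n) H ≤ H²`, for all `n ≥ 1`, `M ≥ 4(n + R)`, `γ ≥ 0`.
A predicate: which `(R, t, c)` work is the content of the amplification theorems (for `R = 2` the squaring argument
gives e.g. `t n = 6000/(2n−1)`, `c = 1`). [cite: Knabe1988, §2] -/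
def KnabeWith (R : ℕ) (t : ℕ → ℝ) (c : ℝ) : Prop :=
  ∀ (M : ℕ) (E : Type) [NormedAddCommGroup E] [InnerProductSpace ℝ E] [CompleteSpace E]
    (Q : (Fin 4 → Fin M) → (E →L[ℝ] E)),
    (∀ x, IsSelfAdjoint (Q x) ∧ Q x * Q x = Q x) →
    (∀ x y, (∃ k, R < cdist (x k) (y k)) → Q x * Q y = Q y * Q x) →
    ∀ (n : ℕ) (γ : ℝ), 1 ≤ n → 4 * (n + R) ≤ M → 0 ≤ γ →
      (∀ x : Fin 4 → Fin M, γ • patchOp Q n x ≤ patchOp Q n x * patchOp Q n x) →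
      (c * (γ - t n)) • totalOp Q ≤ totalOp Q * totalOp Q

end Literature.Analysis.OperatorTheory.KnabeDevice

end
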